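import Summits.AtomisticToContinuum.HydrodynamicLimit.Theses.OneFlightGossipEngine
import Summits.AtomisticToContinuum.HydrodynamicLimit.Theorems.EquilibriumClampedCollisionalWindowLD.Negative.MainBound
import Summits.AtomisticToContinuum.HydrodynamicLimit.Theorems.EquilibriumClampedCollisionalWindowLD.Negative.FinalIneq2
import Summits.AtomisticToContinuum.HydrodynamicLimit.Theorems.ClampedTransferWindowLD.Negative.ClampAfterWindowFalse
import Literature.Analysis.FunctionSpaces.TorusSpaceTime

/-!
# Disproof of `LocalClampedTransferLDAlongFamilies` (stmt-AtomisticToContinuum-17691, route OneFlightGossipEngine,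
crux #4 = the REPAIRED COLLISIONAL NODE) — work file v2, findings

refuter-cdisprove-stmt-AtomisticToContinuum-17691-0, 2026-08-17, cycle 1. The crux ELABORATES (probe rc 0, one sorry) and
is typed faithfully (symbol-by-symbol reading in §1; no junk found). NO KILL: like its constant-family rung C′ =
`TwoClocks.ClampedTransferWindowLD` (16623; standing disproof `Cruxes/ClampedTransferWindowLD/Disproof.lean`, whose §2 obstruction
analysis and MD statics I cite and do not repeat) the statement resists every certifiable witness for a structural reason (§2);
what is new in 17691 — LOCAL Gibbs data, one-parameter families with s-uniform thresholds, x-frozen EOS coefficients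
`Z(ρ₀(x)σ³), Z′(ρ₀(x)σ³)` with `ρ₀ = rhoLim (profileOf a_s) σ`, the deterministic centrings, the packing guard — is audited
in §3 and opens no certifiable attack either. Kernel-checked content (§4, both LANDED as `Negative/` lemmas):
(a) `localClampedTransferLDAlongFamilies_false_without_energyImpulse` — any proof must use the ENERGY part of the transfer
    activity (p144872, ACCEPTED, `Theorems/LocalClampedTransferLDAlongFamilies/Negative/FalseWithoutEnergyImpulse.lean`);
(c) `not_localClampedTransferLDAlongFamilies_clampAfterWindow` — the natural strengthening "clamp level chosen after the window"
    is false (p145718, `Theorems/LocalClampedTransferLDAlongFamilies/Negative/ClampAfterWindowFalse.lean`), i.e. `β₀ = β₀(V)`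
    is essential and `τ₀` cannot be uniform in `V`.

## §1 Reading of the statement as typed

* Binders: `∃η₀>0 ∀t₁ ∀a θ₀ u₀ (slices of a continuous; a, θ₀, u₀ jointly continuous; a, θ₀ > 0) ∀σ∈(0,1/2)
  [guard: ∀s∈[0,t₁], σ³·(⨆ a_s) ≤ η₀ ∫a_s] ∀Φ ∀φ [IsSmoothSpaceTimeOn (Icc 0 t₁) φ] ∃V₀ ∀V≥V₀ ∃β₀ ∀|β|≤β₀ ∀ε>0 ∃τ₀ ∀τ≥τ₀
  ∃N₀ ∀N≥N₀ ∀s∈[0,t₁]`. For `t₁ < 0` everything is vacuous (true); the refuter controls the sign of β, ε, τ, N (τ, N large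
  AFTER β₀), and all profiles/σ/Φ/φ BEFORE V₀, β₀.
* `ρ₀ = rhoLim (profileOf a_s) σ`: the cluster-expansion limit density of the NORMALISED activity `a_s/∫a_s` (`profileOf`
  normalises, so the canonical law's insensitivity to the scale of `a` is respected; `∫ρ₀ = 1`; positions LLN PROVED,
  `localGibbs_densityLLN_holds`). The guard `σ³ sup a_s ≤ η₀∫a_s` forces `σ³ ≤ η₀` (volume 1) and `σ³·sup β ≤ η₀`: the
  low-density chart where `rhoLim`, `Z = hsCompressibility` and `Z′ = deriv hsCompressibility` are honest (HsEosLowDensity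
  PROVED); `η₀` is the statement's to choose — no degenerate-EOS / divergent-series attack.
* `P = localGibbsLaw … (Φ N) = localGibbsMeasure σ a_s u_s θ_s N` (`localGibbsLaw_eq`): a probability measure `≪` Liouville,
  velocities exactly Maxwellian `M_{1,u₀(x),θ₀(x)}` and independent given positions; the flow only types the phase space.
* Records are ORDERED pairs (each binary collision twice); `act i` counts each collision of `i` once (records with
  `fst = i`); `Xm k = Σ_once ω_iω_j (φ_s(x_i) − φ_s(x_j)) Δv_i^k`, `Xe = Σ_once ω_iω_j (φ_s(x_i) − φ_s(x_j)) Δ(‖v_i‖²/2)`.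
* `Am k = ∫₀ʷ Σ_i ∂_kφ_s(x_i)[θ₀ρ₀σ³Z′ + (1/3)(Z−1)‖v_i − u₀(x_i)‖²](x_i(r)) dr − w(N+1)∫ρ₀∂_kφ_s θ₀ρ₀σ³Z′`: only the `Z′`
  part is centred; the `(Z−1)‖v−u₀‖²` part and `Xm` are both uncentred and their means cancel iff the virial identity
  `p_ex = ρθ(Z(ρσ³) − 1)` holds locally (it does to leading order in the chart; linear responses `∂_ρp_ex = θ(Z−1) + θρσ³Z′`,
  `∂_θp_ex = ρ(Z−1)` are exactly the two A-coefficients; energy row = `u₀·(momentum row) + θ₀(Z−1)∇φ·(v−u₀)`, the response of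
  the collisional work flux `p_ex u`). Paper audit of signs/normalisations agrees with C′'s (16623 Disproof §1, MD §4).
* No junk: `⨆` over compact `T3` of a continuous slice; `∫` over `T3` (volume 1); interval integrals of bounded measurable
  integrands on good `z` (`P`-a.e.); `ENNReal.ofReal ∘ exp`.

## §2 Why every certifiable witness fails (inherited from C′, checked against the family shape)

GAIN: contact gives `|φ_s(x_i) − φ_s(x_j)| ≤ ‖∇φ_s‖_∞ ε_N`; a retained sphere has `Σ_coll (‖Δv_i‖ + |Δ‖v_i‖²|/2) ≤ Vτ/σ` and
`ε_N τ/σ = w`, so `|w⁻¹Xm k|, |w⁻¹Xe| ≤ ½‖∇φ_s‖_∞ V (N+1)` PATHWISE; `β₀` is chosen after `V, φ, σ` and all profiles, so a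
witness must produce an EXTENSIVE deviation at a per-particle Gibbs cost below `β₀·C`, i.e. arbitrarily small.
COST: a Lean witness must certify every trajectory (`CertificateUniqueness`), i.e. freeze all spheres to velocity tolerance
`≲ (N+1)^{-1/3}/w = 1/τ`: cost `≥ 3(N+1) log τ` with `τ ≥ τ₀(β, ε)` chosen after `β₀`. Dead for every frozen design; §4(c)
quantifies the only certifiable reordering. Non-certified mechanisms (density/temperature waves: second order vs quadratic cost;
non-Maxwellian or anisotropic velocity laws: Maxwellise in O(1) free times, `O(1/(τσ²))` of the window; boosts: `V₀` after `u₀`;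
crystal at relative gap `θ₀/V`: ratio `βV‖∇φ‖/(6 log V + 6 log(1/σ))`, killed by `β₀(V)`) are all absorbed by `β₀` or `τ → ∞`.

## §3 What is new in 17691 and why it does not open an attack

* x-FROZEN COEFFICIENTS. For non-uniform `a_s, θ_s` the mean of `Y = w⁻¹(X − A)` is no longer zero by 𝕋³-translation; it is
  `o(N)` iff the local virial identity holds with the THERMODYNAMIC `Z` — true to leading order in the chart, with corrections
  `O(ε_N∇)` (profile gradients) and `O(Kn) = O((N+1)^{-1/3})` (Chapman–Enskog drift of the local Maxwellian over the window).
  A mean-level mismatch would refute by Jensen (`E e^{βY} ≥ e^{βE Y}`, both signs of β), but `E[w⁻¹X]` is a collision-rate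
  statistic of Gibbs-started deterministic dynamics — not computable in Lean. The differencing trick (statement at `a` and at
  `λa` share `P` and `X`) is empty: `profileOf` normalises, `ρ₀` is scale-free.
* CENTRING. Only the `Z′` part is centred (by `w(N+1)∫ρ₀∂φθ₀ρ₀σ³Z′`); its static fluctuation `Σ_i h(x_i) − (N+1)∫ρ₀h`,
  `h = ∂_kφθ₀ρ₀σ³Z′`, persists through the window and has NON-vanishing exponential rate on its own — it must be cancelled by
  the density response of `X` at all mesoscopic wavelengths (`c_ρ = Z−1+ρσ³Z′`, confirmed numerically at uniform density by the
  16623 MD, §4 there). This is the designed Boltzmann–Gibbs cancellation, not a loophole; the x-dependent version differs by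
  profile-gradient terms `O(ε_N)`.
* FAMILIES / s-UNIFORMITY. `s` is a parameter; `[0,t₁] × 𝕋³` compact and joint continuity make every sup/inf entering
  `V₀, β₀, τ₀, N₀` uniform. Dropping joint continuity (unbounded `θ(s)`) would let the clamp fire typically at some `s`, but the
  resulting deficit is again a dynamical mean, not certifiable. `t₁ = 0` (used in §4) is the constant-in-s case.
* GUARD. Scale-free in `a` (shape only); forces `σ³ ≤ η₀`; `η₀` first ⇒ the statement lives in the dilute chart. Dropping it
  only exposes junk values of `rhoLim`/`deriv`, nothing certifiable.
* ENERGY ROW, `u₀(x)` VARYING. `Xe = Xe_th + (u₀-weighted momentum rows)` only approximately now (u₀ differs by `ε_N∇u₀`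
  across a contact); the clamp is not Galilean-invariant but `V₀` is chosen after `u₀`; the term `θ₀(Z−1)∫₀ʷΣ∇φ·(v−u₀)` is a
  line integral along each path (telescopes exactly only for constant coefficients) with window-averaged-velocity statistics,
  rate `O(β²θ₀³(Z−1)²/(τσ²)) → 0` on paper (tagged-particle velocity decorrelation — open, plausible).
VERDICT: the honest content is F1 (N-uniform window LD of transfer-clamped collisional currents over `τσ² → ∞` free times under
local Gibbs data) + F2 (tagged transfer-activity LLN making the clamp deficit `o(N)` at exponential scale) + the local virial
identity with the thermodynamic EOS along the chart — open, not refutable here.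

## §4 Lean content (all sorry-free, axioms `propext, Classical.choice, Quot.sound`)

(a) `LocalClampedTransferLDAlongFamiliesWithoutEnergyImpulse` := the crux verbatim with `|Δ‖v_i‖²|/2` deleted from `act`;
    `localClampedTransferLDAlongFamilies_false_without_energyImpulse : ¬ …` — the 13733 frozen line-lattice Newton cradle
    (landed `Theorems/EquilibriumClampedCollisionalWindowLD/Negative/*`: `Lat.lintegral_ge`, `LatW.final_ineq`, `flowFam`)
    at the constant family `t₁ = 0, a = θ₀ = 1, u₀ = 0, σ = (4/5)/l² < η₀` (guard: `σ³ ≤ σ ≤ η₀`), `φ(s,·) = cos 2πx₀`;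
    reduction of the family shape: `rhoLim (profileOf 1) σ = fun _ => C` by `funext rfl`, `Z := Z(Cσ³)`,
    `Z′ := C·Z′(Cσ³)` (`ring`), energy-row centring `= 0` by `u₀ = 0` (`simp`). LANDED p144872.
(c) `LocalClampedTransferLDAlongFamiliesClampAfterWindow` := the crux verbatim with `∃V₀ ∀V` moved after `∀τ`;
    `not_localClampedTransferLDAlongFamilies_clampAfterWindow : ¬ …` — same cradle at `V = max V₀ ((σ/τ)(2V_hi + 3V_hi²))`
    through `ClampedTransferWindowLDNegative.lintegral_geT` (transfer clamp, landed p128026). Proposal p145718.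
(b) tightness / (d) targets: none this cycle (no line picked, `stuck_stubs = []`).
-/

noncomputable section

open Real
open scoped InnerProductSpace

namespace Summit.AtomisticToContinuum.HydrodynamicLimit.Cruxes.LocalClampedTransferLDAlongFamilies.Disproof

open Summit.AtomisticToContinuum.HydrodynamicLimit.Theorems
open Summit.AtomisticToContinuum.HydrodynamicLimit.Theorems.EquilibriumClampedCollisionalWindowLDNegative
open Summit.AtomisticToContinuum.HydrodynamicLimit.Theorems.ClampedTransferWindowLDNegative
open MeasureTheory Literature.Analysis.FluidPDE Literature.Analysis.FunctionSpaces Literature.MathematicalPhysics.KineticTheory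

/-! ## (a) Load-bearing hypothesis: the ENERGY part of the transfer activity -/

/-- `LocalClampedTransferLDAlongFamilies` with the hypothesis "the clamp sees the energy impulse" DROPPED: the
activity is the momentum impulse `(σ/τ) Σ ‖Δv_i‖` only (everything else — local Gibbs data along families, packing
guard, x-frozen EOS coefficients, centrings — verbatim). -/
def LocalClampedTransferLDAlongFamiliesWithoutEnergyImpulse : Prop :=
  ∃ η₀ : ℝ, 0 < η₀ ∧ ∀ (t₁ : ℝ) (a θ₀ : ℝ → Literature.MathematicalPhysics.KineticTheory.T3 → ℝ) (u₀ : ℝ → Literature.MathematicalPhysics.KineticTheory.T3 → Literature.MathematicalPhysics.KineticTheory.V3) (ha : ∀ s, Continuous (a s)), Continuous (Function.uncurry a) → Continuous (Function.uncurry θ₀) → Continuous (Function.uncurry u₀) → ∀ (ha0 : ∀ s x, 0 < a s x), (∀ s x, 0 < θ₀ s x) → ∀ σ : ℝ, 0 < σ → σ < 1 / 2 → (∀ s ∈ Set.Icc 0 t₁, σ ^ 3 * (⨆ x, a s x) ≤ η₀ * ∫ x, a s x) → ∀ Φ : (N : ℕ) → Literature.Analysis.FluidPDE.HardSphereFlow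 (Literature.Analysis.FluidPDE.Torus.geometry (Fin 3)) (Literature.MathematicalPhysics.KineticTheory.hsDiameter σ N) (N + 1), ∀ φ : ℝ → Literature.MathematicalPhysics.KineticTheory.T3 → ℝ, Literature.Analysis.FunctionSpaces.Torus.IsSmoothSpaceTimeOn (Set.Icc 0 t₁) φ → ∃ V₀ : ℝ, 0 < V₀ ∧ ∀ V : ℝ, V₀ ≤ V → ∃ β₀ : ℝ, 0 < β₀ ∧ ∀ β : ℝ, |β| ≤ β₀ → ∀ ε : ℝ, 0 < ε → ∃ τ₀ : ℝ, 0 < τ₀ ∧ ∀ τ : ℝ, τ₀ ≤ τ → ∃ N₀ : ℕ, ∀ N : ℕ, N₀ ≤ N → ∀ s ∈ Set.Icc 0 t₁, (let ρ₀ : Literature.MathematicalPhysics.KineticTheory.T3 → ℝ := Literature.MathematicalPhysics.KineticTheory.rhoLim (Literature.MathematicalPhysics.KineticTheory.profileOf (a s) (ha s) (ha0 s)) σ; let w : ℝ := τ * ((N : ℝ) + 1) ^ (-(1 / 3 : ℝ)); let P := Literature.MathematicalPhysics.KineticTheory.localGibbsLaw σ (a s) (u₀ s) (θ₀ s) N (Φ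 N); let Z : Literature.MathematicalPhysics.KineticTheory.T3 → ℝ := fun x => Literature.MathematicalPhysics.KineticTheory.hsCompressibility (ρ₀ x * σ ^ 3); let Z' : Literature.MathematicalPhysics.KineticTheory.T3 → ℝ := fun x => deriv Literature.MathematicalPhysics.KineticTheory.hsCompressibility (ρ₀ x * σ ^ 3); let act := fun (i : Fin (N + 1)) z => σ / τ * (Φ N).collisionSum (Set.Ioc 0 w) (fun c => if c.fst = i then ‖c.postVel.1 - c.preVel.1‖ else 0) z; let ω := fun (i : Fin (N + 1)) z => if act i z ≤ V then (1 : ℝ) else 0; let Xm := fun (k : Fin 3) z => (Φ N).collisionSum (Set.Ioc 0 w) (fun c => ω c.fst z * ω c.snd z * ((φ s c.fstPos - φ s c.sndPos) * (c.postVel.1 k - c.preVel.1 k)) / 2) z; let Am := fun (k : Fin 3) z => (∫ r in (0 : ℝ)..w, ∑ i : Fin (N + 1), Literature.Analysis.FunctionSpaces.Torus.partialDeriv k (φ s) ((Φ N).flow r z i).1 * (θ₀ s ((Φ N).flow r z i).1 * (ρ₀ ((Φ N).flow r z i).1 * σ ^ 3) * Z' ((Φ N).flow r z i).1 + (1 /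 3) * (Z ((Φ N).flow r z i).1 - 1) * ‖((Φ N).flow r z i).2 - u₀ s ((Φ N).flow r z i).1‖ ^ 2)) - w * ((N : ℝ) + 1) * ∫ x, ρ₀ x * Literature.Analysis.FunctionSpaces.Torus.partialDeriv k (φ s) x * (θ₀ s x * (ρ₀ x * σ ^ 3) * Z' x); let Xe := fun z => (Φ N).collisionSum (Set.Ioc 0 w) (fun c => ω c.fst z * ω c.snd z * ((φ s c.fstPos - φ s c.sndPos) * ((‖c.postVel.1‖ ^ 2 - ‖c.preVel.1‖ ^ 2) / 2)) / 2) z; let Ae := fun z => (∫ r in (0 : ℝ)..w, ∑ i : Fin (N + 1), ((∑ l : Fin 3, u₀ s ((Φ N).flow r z i).1 l * Literature.Analysis.FunctionSpaces.Torus.partialDeriv l (φ s) ((Φ N).flow r z i).1) * (θ₀ s ((Φ N).flow r z i).1 * (ρ₀ ((Φ N).flow r z i).1 * σ ^ 3) * Z' ((Φ N).flow r z i).1 + (1 / 3) * (Z ((Φ N).flow r z i).1 - 1) * ‖((Φ N).flow r z i).2 - u₀ s ((Φ N).flow r z i).1‖ ^ 2) + θ₀ s ((Φ N).flow r z i).1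 * (Z ((Φ N).flow r z i).1 - 1) * (∑ l : Fin 3, Literature.Analysis.FunctionSpaces.Torus.partialDeriv l (φ s) ((Φ N).flow r z i).1 * (((Φ N).flow r z i).2 - u₀ s ((Φ N).flow r z i).1) l))) - w * ((N : ℝ) + 1) * ∫ x, ρ₀ x * (∑ l : Fin 3, u₀ s x l * Literature.Analysis.FunctionSpaces.Torus.partialDeriv l (φ s) x) * (θ₀ s x * (ρ₀ x * σ ^ 3) * Z' x); (∀ k : Fin 3, ∫⁻ z, ENNReal.ofReal (Real.exp (β * (w⁻¹ * Xm k z - w⁻¹ * Am k z))) ∂P ≤ ENNReal.ofReal (Real.exp (ε * ((N : ℝ) + 1)))) ∧ ∫⁻ z, ENNReal.ofReal (Real.exp (β * (w⁻¹ * Xe z - w⁻¹ * Ae z))) ∂P ≤ ENNReal.ofReal (Real.exp (ε * ((N : ℝ) + 1))))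

/-- **Any proof of the crux must use the energy part `|Δ‖v_i‖²|/2` of the transfer activity**: with the momentum
impulse alone the ENERGY row fails at the constant family `a = θ₀ = 1, u₀ = 0`, `t₁ = 0`, `σ = (4/5)/l²`
(`σ³ ≤ η₀`), `φ(s, x) = cos 2π x₀`, on the frozen line-lattice Newton-cradle witness of the refutation of
stmt-13733 (landed helper modules `Theorems/EquilibriumClampedCollisionalWindowLD/Negative/*`): the cradle spheres
have momentum activity `(σ/τ)·2V_p → 0 ≤ V` (clamp never fires) while each transfer moves the energy `t⁶/2` one slot up
the gradient of `-φ`. The x-frozen coefficients are constants here (`ρ₀ = rhoLim (profileOf 1) σ` does not depend on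
`x`), the centring of the energy row is multiplied by `u₀ = 0`. [folklore] -/
theorem localClampedTransferLDAlongFamilies_false_without_energyImpulse :
    ¬ LocalClampedTransferLDAlongFamiliesWithoutEnergyImpulse := by
  classical
  rintro ⟨η₀, hη₀, H⟩
  -- the packing fraction `σ = (4/5)/l²`, with `σ < η₀` (so that `σ³ ≤ σ ≤ η₀`: the packing guard holds for `a ≡ 1`)
  obtain ⟨l, hl, hlσ⟩ : ∃ l : ℕ, 2 ≤ l ∧ (4 / 5 : ℝ) / (l : ℝ) ^ 2 < η₀ := by
    refine ⟨⌈1 / η₀⌉₊ + 2, by omega, ?_⟩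
    have h1 : 1 / η₀ ≤ ⌈1 / η₀⌉₊ := Nat.le_ceil _
    have hl2 : (1 / η₀ : ℝ) + 2 ≤ ((⌈1 / η₀⌉₊ + 2 : ℕ) : ℝ) := by push_cast; linarith
    have hpos : 0 < 1 / η₀ := by positivity
    set L : ℝ := ((⌈1 / η₀⌉₊ + 2 : ℕ) : ℝ)
    have hL : 1 / η₀ < L := by linarith
    have hL1 : 1 ≤ L := by linarith
    rw [div_lt_iff₀ (by positivity)]
    have : 1 < η₀ * L := by rwa [div_lt_iff₀' hη₀] at hL
    nlinarith
  set σ : ℝ := (4 / 5) / (l : ℝ) ^ 2 with hσdef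
  have hl0 : (0 : ℝ) < l := by exact_mod_cast (show 0 < l by omega)
  have hl2 : (2 : ℝ) ≤ l := by exact_mod_cast hl
  have hσ : 0 < σ := by positivity
  have hσ5 : σ ≤ 1 / 5 := by
    rw [hσdef, div_le_iff₀ (by positivity)]; nlinarith
  have hσ2 : σ < 1 / 2 := by linarith
  have hguard : ∀ s ∈ Set.Icc (0 : ℝ) 0, σ ^ 3 * (⨆ x : T3, (fun (_ : ℝ) (_ : T3) => (1 : ℝ)) s x) ≤
      η₀ * ∫ x : T3, (fun (_ : ℝ) (_ : T3) => (1 : ℝ)) s x := by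
    intro s _
    have hsup : (⨆ x : T3, (fun (_ : ℝ) (_ : T3) => (1 : ℝ)) s x) = 1 := by simp
    have hint : (∫ x : T3, (fun (_ : ℝ) (_ : T3) => (1 : ℝ)) s x) = 1 := by simp
    rw [hsup, hint, mul_one, mul_one]
    have hσ1 : σ ≤ 1 := by linarith
    calc σ ^ 3 ≤ σ ^ 1 := pow_le_pow_of_le_one hσ.le hσ1 (by norm_num)
      _ = σ := pow_one σ
      _ ≤ η₀ := hlσ.le
  specialize H 0 (fun _ _ => 1) (fun _ _ => 1) (fun _ _ => 0) (fun _ => continuous_const) continuous_const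
    continuous_const continuous_const (fun _ _ => one_pos) (fun _ _ => one_pos) σ hσ hσ2 hguard (flowFam hσ hσ2)
    (fun _ => phi) (Torus.isSmoothSpaceTimeOn_const isSmooth_phi _)
  obtain ⟨V₀, hV₀, H⟩ := H
  specialize H (max V₀ 1) (le_max_left _ _)
  obtain ⟨β₀, hβ₀, H⟩ := H
  specialize H β₀ (by rw [abs_of_pos hβ₀]) 1 one_pos
  obtain ⟨τ₀, hτ₀, H⟩ := H
  -- the x-frozen coefficients are constants
  set C : ℝ := rhoLim (profileOf (fun _ : T3 => (1 : ℝ)) continuous_const (fun _ => one_pos)) σ 0 with hC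
  have hρ : rhoLim (profileOf (fun _ : T3 => (1 : ℝ)) continuous_const (fun _ => one_pos)) σ = fun _ => C :=
    funext fun x => rfl
  -- `Z` and the choice of `t` (`τ = t⁴`)
  set Z : ℝ := hsCompressibility (C * σ ^ 3) with hZ
  set Z' : ℝ := deriv hsCompressibility (C * σ ^ 3) with hZ'
  obtain ⟨t, ht, hτt, hbig⟩ : ∃ t : ℕ, 24 * l ^ 2 ≤ t ∧ τ₀ ≤ (t : ℝ) ^ 4 ∧
      39 * (l : ℝ) ^ 2 * (224 + 6 * l + 40 * β₀ * |Z - 1|) ≤ β₀ * t := by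
    set X : ℝ := 39 * (l : ℝ) ^ 2 * (224 + 6 * l + 40 * β₀ * |Z - 1|) / β₀ with hX
    refine ⟨⌈τ₀⌉₊ + 24 * l ^ 2 + ⌈X⌉₊ + 1, by omega, ?_, ?_⟩
    · have h1 : τ₀ ≤ ⌈τ₀⌉₊ := Nat.le_ceil _
      have h2 : (⌈τ₀⌉₊ : ℝ) ≤ ((⌈τ₀⌉₊ + 24 * l ^ 2 + ⌈X⌉₊ + 1 : ℕ) : ℝ) := by exact_mod_cast (by omega)
      have h3 : (1 : ℝ) ≤ ((⌈τ₀⌉₊ + 24 * l ^ 2 + ⌈X⌉₊ + 1 : ℕ) : ℝ) := by exact_mod_cast (by omega)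
      calc τ₀ ≤ ((⌈τ₀⌉₊ + 24 * l ^ 2 + ⌈X⌉₊ + 1 : ℕ) : ℝ) := h1.trans h2
        _ = ((⌈τ₀⌉₊ + 24 * l ^ 2 + ⌈X⌉₊ + 1 : ℕ) : ℝ) ^ 1 := (pow_one _).symm
        _ ≤ _ := pow_le_pow_right₀ h3 (by norm_num)
    · have h1 : X ≤ ⌈X⌉₊ := Nat.le_ceil _
      have h2 : (⌈X⌉₊ : ℝ) ≤ ((⌈τ₀⌉₊ + 24 * l ^ 2 + ⌈X⌉₊ + 1 : ℕ) : ℝ) := by exact_mod_cast (by omega)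
      have h3 : X ≤ ((⌈τ₀⌉₊ + 24 * l ^ 2 + ⌈X⌉₊ + 1 : ℕ) : ℝ) := h1.trans h2
      have := mul_le_mul_of_nonneg_left h3 hβ₀.le
      rw [hX, mul_div_cancel₀ _ hβ₀.ne'] at this
      exact this
  specialize H ((t : ℝ) ^ 4) hτt
  obtain ⟨N₀, H⟩ := H
  -- the choice of `n` and `N + 1 = (l n)³`
  set n : ℕ := N₀ + 18 * t ^ 7 * l ^ 2 + 10 with hn
  have hn2 : 2 ≤ n := by omega
  have hn1 : 1 ≤ n := by omega
  set N : ℕ := (l * n) ^ 3 - 1 with hNdef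
  have hln : 1 ≤ l * n := Nat.mul_pos (by omega) (by omega)
  have hN : N + 1 = (l * n) ^ 3 := by
    have : 1 ≤ (l * n) ^ 3 := Nat.one_le_pow _ _ hln; omega
  have hN₀ : N₀ ≤ N := by
    have h1 : l * n ≤ (l * n) ^ 3 := by
      calc l * n = (l * n) ^ 1 := (pow_one _).symm
        _ ≤ (l * n) ^ 3 := Nat.pow_le_pow_right hln (by norm_num)
    have h2 : n ≤ l * n := Nat.le_mul_of_pos_left n (by omega)
    omega
  specialize H N hN₀ 0 (Set.left_mem_Icc.2 le_rfl)
  obtain ⟨-, hE⟩ := H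
  -- the lattice
  set Λ := LatW' l n t with hΛ
  have hΛeq : Λ = LatW l n t := LatW'_eq hl hn1
  have hcard : Fintype.card Λ.Slot = N + 1 := by rw [hΛeq, LatW.card_slot, hN]
  have hchart : 4 * (6 * (t : ℝ) ^ 7 * (l : ℝ) ^ 2 + 4) ≤ (l : ℝ) ^ 3 * n := by
    have hn' : ((18 * t ^ 7 * l ^ 2 + 10 : ℕ) : ℝ) ≤ n := by exact_mod_cast (by omega)
    push_cast at hn'
    have hl8 : (8 : ℝ) ≤ (l : ℝ) ^ 3 := by
      have := pow_le_pow_left₀ (by norm_num : (0:ℝ) ≤ 2) hl2 3; norm_num at this; exact this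
    have h0 : (0 : ℝ) ≤ (t : ℝ) ^ 7 * (l : ℝ) ^ 2 := by positivity
    have h1 : (8 : ℝ) * n ≤ (l : ℝ) ^ 3 * n := mul_le_mul_of_nonneg_right hl8 (by positivity)
    nlinarith
  have hW : Λ.WinOK := by rw [hΛeq]; exact LatW.winOK hl ht hn1 hchart
  have hG : Λ.GainOK := by rw [hΛeq]; exact LatW.gainOK hl ht hn1
  obtain ⟨hε12, hr12, -⟩ : Λ.P.ε < 1 / 2 ∧ Λ.P.r < 1 / 2 ∧ (4 / 5 : ℝ) / (l : ℝ) ^ 2 ≤ 1 / 2 := by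
    rw [hΛeq]; exact LatW.small_facts hl ht hn1
  have hn0 : (0:ℝ) < n := by exact_mod_cast (show 0 < n by omega)
  have hT := bpar.Tpos hl ht
  have hc := LatW.c_pos (l := l) (n := n) hl hn1
  have hw0 : 0 < Λ.w := by show 0 < cscale l n * ((t : ℝ) ^ 4 * (l : ℝ) ^ 2); positivity
  have hεσ : hsDiameter σ N = Λ.P.ε := rfl
  have hgoodP : localGibbsMeasure σ (fun _ => 1) (fun _ => 0) (fun _ => (1 : ℝ)) N (flowFam hσ hσ2 N).goodᶜ = 0 :=
    localGibbsMeasure_absolutelyContinuous σ _ _ _ N (flowFam hσ hσ2 N) (flowFam hσ hσ2 N).measure_compl_good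
  have hκ : 0 ≤ σ / (t : ℝ) ^ 4 := by positivity
  have hVcl : σ / (t : ℝ) ^ 4 * (2 * Λ.P.Vhi) ≤ max V₀ 1 := by
    refine le_trans ?_ (le_max_right _ _)
    rw [hΛeq, LatW.P_eq, Params.scale_Vhi _ hc.ne']
    obtain ⟨-, -, -, hVhi⟩ := bpar.V_bd hl ht
    have ht3 := bpar.T3 hl ht
    have h1 := bpar.T1 hl ht
    rw [div_mul_eq_mul_div, div_le_one (by positivity)]
    have : (t : ℝ) ^ 4 = t * (t : ℝ) ^ 3 := by ring
    nlinarith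
  obtain ⟨-, -, -, w4, w5, -⟩ := bpar.win_facts hl ht
  have hkK : 4 * t ^ 7 * l ^ 2 + 1 ≤ Λ.P.K := by rw [hΛeq]; exact w5
  have hkw : ((4 * t ^ 7 * l ^ 2 : ℕ) : ℝ) * Λ.P.θhi ≤ Λ.w := by
    rw [hΛeq, LatW.P_eq, Params.scale_θhi _ hc.ne', LatW.w_eq]
    calc ((4 * t ^ 7 * l ^ 2 : ℕ) : ℝ) * (cscale l n * (bpar l t).θhi)
        = cscale l n * (((4 * t ^ 7 * l ^ 2 : ℕ) : ℝ) * (bpar l t).θhi) := by ring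
      _ ≤ cscale l n * ((t : ℝ) ^ 4 * (l : ℝ) ^ 2) := mul_le_mul_of_nonneg_left w4 hc.le
  have hM : 24 * Λ.m ≤ Λ.M := by
    show 24 * (6 * t ^ 7 * l ^ 2 + 3) ≤ l ^ 3 * n
    have hl8 : 8 ≤ l ^ 3 := by
      calc 8 = 2 ^ 3 := by norm_num
        _ ≤ l ^ 3 := Nat.pow_le_pow_left hl 3
    have hn' : 18 * t ^ 7 * l ^ 2 + 10 ≤ n := by omega
    calc 24 * (6 * t ^ 7 * l ^ 2 + 3) = 8 * (18 * t ^ 7 * l ^ 2 + 9) := by ring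
      _ ≤ l ^ 3 * n := Nat.mul_le_mul hl8 (by omega)
  -- the main bound and the final inequality (old machinery, with `Z := Z(Cσ³)`, `Z' := C·Z'(Cσ³)`)
  have key := Lat.lintegral_ge (Λ := Λ) (Φ := flowFam hσ hσ2 N) hcard hW hG hε12 hr12 hw0 (by linarith) hεσ hgoodP
    (V := max V₀ 1) (Z := Z) (Z' := C * Z') hκ hVcl hβ₀.le hkK hkw hM
  have key' : ENNReal.ofReal (((N + 1).factorial : ℝ) * Real.exp (Λ.Fmin N (4 * t ^ 7 * l ^ 2) β₀ Z) * Λ.evB N) ≤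
      ∫⁻ z, ENNReal.ofReal (Real.exp (β₀ * (Λ.w⁻¹ * Λ.XeF (flowFam hσ hσ2 N) (σ / (t : ℝ) ^ 4) (max V₀ 1) z -
        Λ.w⁻¹ * (Λ.AeF (flowFam hσ hσ2 N) σ Z (C * Z') z - 0))))
        ∂(localGibbsMeasure σ (fun _ => 1) (fun _ => 0) (fun _ => (1 : ℝ)) N) := by
    simpa only [sub_zero] using key
  have hfin := LatW.final_ineq hl ht hn2 hN hβ₀ Z hbig
  rw [← hΛeq] at hfin
  have hlt : ENNReal.ofReal (Real.exp (1 * ((N : ℝ) + 1))) <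
      ENNReal.ofReal (((N + 1).factorial : ℝ) * Real.exp (Λ.Fmin N (4 * t ^ 7 * l ^ 2) β₀ Z) * Λ.evB N) := by
    rw [one_mul, ENNReal.ofReal_lt_ofReal_iff (lt_trans (Real.exp_pos _) hfin)]
    exact hfin
  -- identify the statement's integral with ours
  have hw : (t : ℝ) ^ 4 * ((N : ℝ) + 1) ^ (-(1 / 3 : ℝ)) = Λ.w := by
    rw [LatW.w_eq_stmt (t := t) hl hn1 hN, hΛeq]
  have hring : (1 : ℝ) * (C * σ ^ 3) * Z' = 1 * σ ^ 3 * (C * Z') := by ring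
  have hcent : Λ.w * ((N : ℝ) + 1) * ∫ x : T3, C * (∑ l : Fin 3, (0 : V3) l *
      Literature.Analysis.FunctionSpaces.Torus.partialDeriv l phi x) * (1 * σ ^ 3 * (C * Z')) = 0 := by
    simp
  simp only [] at hE
  rw [localGibbsLaw_eq, hw, hρ] at hE
  simp only [] at hE
  rw [hring, hcent] at hE
  exact absurd (lt_of_lt_of_le hlt (key'.trans hE)) (lt_irrefl _)


/-! ## (c) A natural strengthening is false: the clamp level may NOT be chosen after the window length -/

/-- `LocalClampedTransferLDAlongFamilies` with the clamp level quantified AFTER the window length: `∃V₀ ∀V≥V₀` moved from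
before `∃β₀` to after `∀τ≥τ₀` (everything else verbatim, INCLUDING the energy impulse in the activity). -/
def LocalClampedTransferLDAlongFamiliesClampAfterWindow : Prop :=
  ∃ η₀ : ℝ, 0 < η₀ ∧ ∀ (t₁ : ℝ) (a θ₀ : ℝ → Literature.MathematicalPhysics.KineticTheory.T3 → ℝ) (u₀ : ℝ → Literature.MathematicalPhysics.KineticTheory.T3 → Literature.MathematicalPhysics.KineticTheory.V3) (ha : ∀ s, Continuous (a s)), Continuous (Function.uncurry a) → Continuous (Function.uncurry θ₀) → Continuous (Function.uncurry u₀) → ∀ (ha0 : ∀ s x, 0 < a s x), (∀ s x, 0 < θ₀ s x) → ∀ σ : ℝ, 0 < σ → σ < 1 / 2 → (∀ s ∈ Set.Icc 0 t₁, σ ^ 3 * (⨆ x, a s x) ≤ η₀ * ∫ x, a s x) → ∀ Φ : (N : ℕ) → Literature.Analysis.FluidPDE.HardSphereFlow (Literature.Analysis.FluidPDE.Torus.geometry (Fin 3)) (Literature.MathematicalPhysics.KineticTheory.hsDiameter σ N) (N + 1), ∀ φ : ℝ → Literature.MathematicalPhysics.KineticTheory.T3 → ℝ, Literature.Analysis.FunctionSpaces.Torus.IsSmoothSpaceTimeOn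 (Set.Icc 0 t₁) φ → ∃ β₀ : ℝ, 0 < β₀ ∧ ∀ β : ℝ, |β| ≤ β₀ → ∀ ε : ℝ, 0 < ε → ∃ τ₀ : ℝ, 0 < τ₀ ∧ ∀ τ : ℝ, τ₀ ≤ τ → ∃ V₀ : ℝ, 0 < V₀ ∧ ∀ V : ℝ, V₀ ≤ V → ∃ N₀ : ℕ, ∀ N : ℕ, N₀ ≤ N → ∀ s ∈ Set.Icc 0 t₁, (let ρ₀ : Literature.MathematicalPhysics.KineticTheory.T3 → ℝ := Literature.MathematicalPhysics.KineticTheory.rhoLim (Literature.MathematicalPhysics.KineticTheory.profileOf (a s) (ha s) (ha0 s)) σ; let w : ℝ := τ * ((N : ℝ) + 1) ^ (-(1 / 3 : ℝ)); let P := Literature.MathematicalPhysics.KineticTheory.localGibbsLaw σ (a s) (u₀ s) (θ₀ s) N (Φ N); let Z : Literature.MathematicalPhysics.KineticTheory.T3 → ℝ := fun x => Literature.MathematicalPhysics.KineticTheory.hsCompressibility (ρ₀ x * σ ^ 3); let Z' : Literature.MathematicalPhysics.KineticTheory.T3 → ℝ := fun x => deriv Literature.MathematicalPhysics.KineticTheory.hsCompressibility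 (ρ₀ x * σ ^ 3); let act := fun (i : Fin (N + 1)) z => σ / τ * (Φ N).collisionSum (Set.Ioc 0 w) (fun c => if c.fst = i then ‖c.postVel.1 - c.preVel.1‖ + |‖c.postVel.1‖ ^ 2 - ‖c.preVel.1‖ ^ 2| / 2 else 0) z; let ω := fun (i : Fin (N + 1)) z => if act i z ≤ V then (1 : ℝ) else 0; let Xm := fun (k : Fin 3) z => (Φ N).collisionSum (Set.Ioc 0 w) (fun c => ω c.fst z * ω c.snd z * ((φ s c.fstPos - φ s c.sndPos) * (c.postVel.1 k - c.preVel.1 k)) / 2) z; let Am := fun (k : Fin 3) z => (∫ r in (0 : ℝ)..w, ∑ i : Fin (N + 1), Literature.Analysis.FunctionSpaces.Torus.partialDeriv k (φ s) ((Φ N).flow r z i).1 * (θ₀ s ((Φ N).flow r z i).1 * (ρ₀ ((Φ N).flow r z i).1 * σ ^ 3) * Z' ((Φ N).flow r z i).1 + (1 / 3) * (Z ((Φ N).flow r z i).1 - 1) * ‖((Φ N).flow r z i).2 - u₀ s ((Φ N).flow r z i).1‖ ^ 2)) - w * ((N : ℝ) + 1) * ∫ x, ρ₀ x * Literature.Analysis.FunctionSpaces.Torus.partialDeriv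 k (φ s) x * (θ₀ s x * (ρ₀ x * σ ^ 3) * Z' x); let Xe := fun z => (Φ N).collisionSum (Set.Ioc 0 w) (fun c => ω c.fst z * ω c.snd z * ((φ s c.fstPos - φ s c.sndPos) * ((‖c.postVel.1‖ ^ 2 - ‖c.preVel.1‖ ^ 2) / 2)) / 2) z; let Ae := fun z => (∫ r in (0 : ℝ)..w, ∑ i : Fin (N + 1), ((∑ l : Fin 3, u₀ s ((Φ N).flow r z i).1 l * Literature.Analysis.FunctionSpaces.Torus.partialDeriv l (φ s) ((Φ N).flow r z i).1) * (θ₀ s ((Φ N).flow r z i).1 * (ρ₀ ((Φ N).flow r z i).1 * σ ^ 3) * Z' ((Φ N).flow r z i).1 + (1 / 3) * (Z ((Φ N).flow r z i).1 - 1) * ‖((Φ N).flow r z i).2 - u₀ s ((Φ N).flow r z i).1‖ ^ 2) + θ₀ s ((Φ N).flow r z i).1 * (Z ((Φ N).flow r z i).1 - 1) * (∑ l : Fin 3, Literature.Analysis.FunctionSpaces.Torus.partialDeriv l (φ s) ((Φ N).flow r z i).1 * (((Φ N).flow r z i).2 - u₀ s ((Φ N).flow r z i).1) l))) - w * ((N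 : ℝ) + 1) * ∫ x, ρ₀ x * (∑ l : Fin 3, u₀ s x l * Literature.Analysis.FunctionSpaces.Torus.partialDeriv l (φ s) x) * (θ₀ s x * (ρ₀ x * σ ^ 3) * Z' x); (∀ k : Fin 3, ∫⁻ z, ENNReal.ofReal (Real.exp (β * (w⁻¹ * Xm k z - w⁻¹ * Am k z))) ∂P ≤ ENNReal.ofReal (Real.exp (ε * ((N : ℝ) + 1)))) ∧ ∫⁻ z, ENNReal.ofReal (Real.exp (β * (w⁻¹ * Xe z - w⁻¹ * Ae z))) ∂P ≤ ENNReal.ofReal (Real.exp (ε * ((N : ℝ) + 1))))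

/-- **The clamp level must be fixed before the window** (`β₀ = β₀(V)` is essential; `β₀(V)·V` must stay bounded up to
logarithms; `τ₀` cannot be uniform in `V`): with `V` chosen after `τ = t⁴`, the refuter takes
`V = max V₀ ((σ/τ)(2V_hi + 3V_hi²))` (`V_hi ≍ t³` the pulse speed bound), at which every sphere of the frozen line-lattice
Newton cradle passes the TRANSFER clamp (`ClampedTransferWindowLDNegative.transferImpulseSum_le`, landed p128026), and the
energy row of the constant family `t₁ = 0, a = θ₀ = 1, u₀ = 0, φ(s,·) = cos 2πx₀` is `≥ (N+1)! e^{F_min} evB > e^{N+1}`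
(`lintegral_geT`). Same reduction of the x-frozen coefficients to constants as in (a). [folklore] -/
theorem not_localClampedTransferLDAlongFamilies_clampAfterWindow :
    ¬ LocalClampedTransferLDAlongFamiliesClampAfterWindow := by
  classical
  rintro ⟨η₀, hη₀, H⟩
  obtain ⟨l, hl, hlσ⟩ : ∃ l : ℕ, 2 ≤ l ∧ (4 / 5 : ℝ) / (l : ℝ) ^ 2 < η₀ := by
    refine ⟨⌈1 / η₀⌉₊ + 2, by omega, ?_⟩
    have h1 : 1 / η₀ ≤ ⌈1 / η₀⌉₊ := Nat.le_ceil _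
    have hl2 : (1 / η₀ : ℝ) + 2 ≤ ((⌈1 / η₀⌉₊ + 2 : ℕ) : ℝ) := by push_cast; linarith
    have hpos : 0 < 1 / η₀ := by positivity
    set L : ℝ := ((⌈1 / η₀⌉₊ + 2 : ℕ) : ℝ)
    have hL : 1 / η₀ < L := by linarith
    have hL1 : 1 ≤ L := by linarith
    rw [div_lt_iff₀ (by positivity)]
    have : 1 < η₀ * L := by rwa [div_lt_iff₀' hη₀] at hL
    nlinarith
  set σ : ℝ := (4 / 5) / (l : ℝ) ^ 2 with hσdef
  have hl0 : (0 : ℝ) < l := by exact_mod_cast (show 0 < l by omega)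
  have hl2 : (2 : ℝ) ≤ l := by exact_mod_cast hl
  have hσ : 0 < σ := by positivity
  have hσ5 : σ ≤ 1 / 5 := by
    rw [hσdef, div_le_iff₀ (by positivity)]; nlinarith
  have hσ2 : σ < 1 / 2 := by linarith
  have hguard : ∀ s ∈ Set.Icc (0 : ℝ) 0, σ ^ 3 * (⨆ x : T3, (fun (_ : ℝ) (_ : T3) => (1 : ℝ)) s x) ≤
      η₀ * ∫ x : T3, (fun (_ : ℝ) (_ : T3) => (1 : ℝ)) s x := by
    intro s _
    have hsup : (⨆ x : T3, (fun (_ : ℝ) (_ : T3) => (1 : ℝ)) s x) = 1 := by simp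
    have hint : (∫ x : T3, (fun (_ : ℝ) (_ : T3) => (1 : ℝ)) s x) = 1 := by simp
    rw [hsup, hint, mul_one, mul_one]
    have hσ1 : σ ≤ 1 := by linarith
    calc σ ^ 3 ≤ σ ^ 1 := pow_le_pow_of_le_one hσ.le hσ1 (by norm_num)
      _ = σ := pow_one σ
      _ ≤ η₀ := hlσ.le
  specialize H 0 (fun _ _ => 1) (fun _ _ => 1) (fun _ _ => 0) (fun _ => continuous_const) continuous_const
    continuous_const continuous_const (fun _ _ => one_pos) (fun _ _ => one_pos) σ hσ hσ2 hguard (flowFam hσ hσ2)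
    (fun _ => phi) (Torus.isSmoothSpaceTimeOn_const isSmooth_phi _)
  obtain ⟨β₀, hβ₀, H⟩ := H
  specialize H β₀ (by rw [abs_of_pos hβ₀]) 1 one_pos
  obtain ⟨τ₀, hτ₀, H⟩ := H
  set C : ℝ := rhoLim (profileOf (fun _ : T3 => (1 : ℝ)) continuous_const (fun _ => one_pos)) σ 0 with hC
  have hρ : rhoLim (profileOf (fun _ : T3 => (1 : ℝ)) continuous_const (fun _ => one_pos)) σ = fun _ => C :=
    funext fun x => rfl
  set Z : ℝ := hsCompressibility (C * σ ^ 3) with hZ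
  set Z' : ℝ := deriv hsCompressibility (C * σ ^ 3) with hZ'
  obtain ⟨t, ht, hτt, hbig⟩ : ∃ t : ℕ, 24 * l ^ 2 ≤ t ∧ τ₀ ≤ (t : ℝ) ^ 4 ∧
      39 * (l : ℝ) ^ 2 * (224 + 6 * l + 40 * β₀ * |Z - 1|) ≤ β₀ * t := by
    set X : ℝ := 39 * (l : ℝ) ^ 2 * (224 + 6 * l + 40 * β₀ * |Z - 1|) / β₀ with hX
    refine ⟨⌈τ₀⌉₊ + 24 * l ^ 2 + ⌈X⌉₊ + 1, by omega, ?_, ?_⟩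
    · have h1 : τ₀ ≤ ⌈τ₀⌉₊ := Nat.le_ceil _
      have h2 : (⌈τ₀⌉₊ : ℝ) ≤ ((⌈τ₀⌉₊ + 24 * l ^ 2 + ⌈X⌉₊ + 1 : ℕ) : ℝ) := by exact_mod_cast (by omega)
      have h3 : (1 : ℝ) ≤ ((⌈τ₀⌉₊ + 24 * l ^ 2 + ⌈X⌉₊ + 1 : ℕ) : ℝ) := by exact_mod_cast (by omega)
      calc τ₀ ≤ ((⌈τ₀⌉₊ + 24 * l ^ 2 + ⌈X⌉₊ + 1 : ℕ) : ℝ) := h1.trans h2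
        _ = ((⌈τ₀⌉₊ + 24 * l ^ 2 + ⌈X⌉₊ + 1 : ℕ) : ℝ) ^ 1 := (pow_one _).symm
        _ ≤ _ := pow_le_pow_right₀ h3 (by norm_num)
    · have h1 : X ≤ ⌈X⌉₊ := Nat.le_ceil _
      have h2 : (⌈X⌉₊ : ℝ) ≤ ((⌈τ₀⌉₊ + 24 * l ^ 2 + ⌈X⌉₊ + 1 : ℕ) : ℝ) := by exact_mod_cast (by omega)
      have h3 : X ≤ ((⌈τ₀⌉₊ + 24 * l ^ 2 + ⌈X⌉₊ + 1 : ℕ) : ℝ) := h1.trans h2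
      have := mul_le_mul_of_nonneg_left h3 hβ₀.le
      rw [hX, mul_div_cancel₀ _ hβ₀.ne'] at this
      exact this
  specialize H ((t : ℝ) ^ 4) hτt
  -- NOW the clamp level is chosen, after `τ = t⁴`: above the transfer activity of every relay sphere
  obtain ⟨V₀, hV₀, H⟩ := H
  set Vc : ℝ := max V₀ (σ / (t : ℝ) ^ 4 * (2 * (bpar l t).Vhi + 3 * (bpar l t).Vhi ^ 2)) with hVc
  specialize H Vc (le_max_left _ _)
  obtain ⟨N₀, H⟩ := H
  set n : ℕ := N₀ + 18 * t ^ 7 * l ^ 2 + 10 with hn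
  have hn2 : 2 ≤ n := by omega
  have hn1 : 1 ≤ n := by omega
  set N : ℕ := (l * n) ^ 3 - 1 with hNdef
  have hln : 1 ≤ l * n := Nat.mul_pos (by omega) (by omega)
  have hN : N + 1 = (l * n) ^ 3 := by
    have : 1 ≤ (l * n) ^ 3 := Nat.one_le_pow _ _ hln; omega
  have hN₀ : N₀ ≤ N := by
    have h1 : l * n ≤ (l * n) ^ 3 := by
      calc l * n = (l * n) ^ 1 := (pow_one _).symm
        _ ≤ (l * n) ^ 3 := Nat.pow_le_pow_right hln (by norm_num)
    have h2 : n ≤ l * n := Nat.le_mul_of_pos_left n (by omega)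
    omega
  specialize H N hN₀ 0 (Set.left_mem_Icc.2 le_rfl)
  obtain ⟨-, hE⟩ := H
  set Λ := LatW' l n t with hΛ
  have hΛeq : Λ = LatW l n t := LatW'_eq hl hn1
  have hcard : Fintype.card Λ.Slot = N + 1 := by rw [hΛeq, LatW.card_slot, hN]
  have hchart : 4 * (6 * (t : ℝ) ^ 7 * (l : ℝ) ^ 2 + 4) ≤ (l : ℝ) ^ 3 * n := by
    have hn' : ((18 * t ^ 7 * l ^ 2 + 10 : ℕ) : ℝ) ≤ n := by exact_mod_cast (by omega)
    push_cast at hn'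
    have hl8 : (8 : ℝ) ≤ (l : ℝ) ^ 3 := by
      have := pow_le_pow_left₀ (by norm_num : (0:ℝ) ≤ 2) hl2 3; norm_num at this; exact this
    have h0 : (0 : ℝ) ≤ (t : ℝ) ^ 7 * (l : ℝ) ^ 2 := by positivity
    have h1 : (8 : ℝ) * n ≤ (l : ℝ) ^ 3 * n := mul_le_mul_of_nonneg_right hl8 (by positivity)
    nlinarith
  have hW : Λ.WinOK := by rw [hΛeq]; exact LatW.winOK hl ht hn1 hchart
  have hG : Λ.GainOK := by rw [hΛeq]; exact LatW.gainOK hl ht hn1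
  obtain ⟨hε12, hr12, -⟩ : Λ.P.ε < 1 / 2 ∧ Λ.P.r < 1 / 2 ∧ (4 / 5 : ℝ) / (l : ℝ) ^ 2 ≤ 1 / 2 := by
    rw [hΛeq]; exact LatW.small_facts hl ht hn1
  have hn0 : (0:ℝ) < n := by exact_mod_cast (show 0 < n by omega)
  have hT := bpar.Tpos hl ht
  have hc := LatW.c_pos (l := l) (n := n) hl hn1
  have hw0 : 0 < Λ.w := by show 0 < cscale l n * ((t : ℝ) ^ 4 * (l : ℝ) ^ 2); positivity
  have hεσ : hsDiameter σ N = Λ.P.ε := rfl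
  have hgoodP : localGibbsMeasure σ (fun _ => 1) (fun _ => 0) (fun _ => (1 : ℝ)) N (flowFam hσ hσ2 N).goodᶜ = 0 :=
    localGibbsMeasure_absolutelyContinuous σ _ _ _ N (flowFam hσ hσ2 N) (flowFam hσ hσ2 N).measure_compl_good
  have hκ : 0 ≤ σ / (t : ℝ) ^ 4 := by positivity
  have hVcl : σ / (t : ℝ) ^ 4 * (2 * Λ.P.Vhi + 3 * Λ.P.Vhi ^ 2) ≤ Vc := by
    refine le_trans (le_of_eq ?_) (le_max_right _ _)
    rw [hΛeq, LatW.P_eq, Params.scale_Vhi _ hc.ne']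
  obtain ⟨-, -, -, w4, w5, -⟩ := bpar.win_facts hl ht
  have hkK : 4 * t ^ 7 * l ^ 2 + 1 ≤ Λ.P.K := by rw [hΛeq]; exact w5
  have hkw : ((4 * t ^ 7 * l ^ 2 : ℕ) : ℝ) * Λ.P.θhi ≤ Λ.w := by
    rw [hΛeq, LatW.P_eq, Params.scale_θhi _ hc.ne', LatW.w_eq]
    calc ((4 * t ^ 7 * l ^ 2 : ℕ) : ℝ) * (cscale l n * (bpar l t).θhi)
        = cscale l n * (((4 * t ^ 7 * l ^ 2 : ℕ) : ℝ) * (bpar l t).θhi) := by ring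
      _ ≤ cscale l n * ((t : ℝ) ^ 4 * (l : ℝ) ^ 2) := mul_le_mul_of_nonneg_left w4 hc.le
  have hM : 24 * Λ.m ≤ Λ.M := by
    show 24 * (6 * t ^ 7 * l ^ 2 + 3) ≤ l ^ 3 * n
    have hl8 : 8 ≤ l ^ 3 := by
      calc 8 = 2 ^ 3 := by norm_num
        _ ≤ l ^ 3 := Nat.pow_le_pow_left hl 3
    have hn' : 18 * t ^ 7 * l ^ 2 + 10 ≤ n := by omega
    calc 24 * (6 * t ^ 7 * l ^ 2 + 3) = 8 * (18 * t ^ 7 * l ^ 2 + 9) := by ring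
      _ ≤ l ^ 3 * n := Nat.mul_le_mul hl8 (by omega)
  have key := lintegral_geT (Λ := Λ) (Φ := flowFam hσ hσ2 N) hcard hW hG hε12 hr12 hw0 (by linarith) hεσ hgoodP
    (V := Vc) (Z := Z) (Z' := C * Z') hκ hVcl hβ₀.le hkK hkw hM
  have key' : ENNReal.ofReal (((N + 1).factorial : ℝ) * Real.exp (Λ.Fmin N (4 * t ^ 7 * l ^ 2) β₀ Z) * Λ.evB N) ≤
      ∫⁻ z, ENNReal.ofReal (Real.exp (β₀ * (Λ.w⁻¹ * XeT Λ (flowFam hσ hσ2 N) (σ / (t : ℝ) ^ 4) Vc z -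
        Λ.w⁻¹ * (Λ.AeF (flowFam hσ hσ2 N) σ Z (C * Z') z - 0))))
        ∂(localGibbsMeasure σ (fun _ => 1) (fun _ => 0) (fun _ => (1 : ℝ)) N) := by
    simpa only [sub_zero] using key
  have hfin := LatW.final_ineq hl ht hn2 hN hβ₀ Z hbig
  rw [← hΛeq] at hfin
  have hlt : ENNReal.ofReal (Real.exp (1 * ((N : ℝ) + 1))) <
      ENNReal.ofReal (((N + 1).factorial : ℝ) * Real.exp (Λ.Fmin N (4 * t ^ 7 * l ^ 2) β₀ Z) * Λ.evB N) := by
    rw [one_mul, ENNReal.ofReal_lt_ofReal_iff (lt_trans (Real.exp_pos _) hfin)]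
    exact hfin
  have hw : (t : ℝ) ^ 4 * ((N : ℝ) + 1) ^ (-(1 / 3 : ℝ)) = Λ.w := by
    rw [LatW.w_eq_stmt (t := t) hl hn1 hN, hΛeq]
  have hring : (1 : ℝ) * (C * σ ^ 3) * Z' = 1 * σ ^ 3 * (C * Z') := by ring
  have hcent : Λ.w * ((N : ℝ) + 1) * ∫ x : T3, C * (∑ l : Fin 3, (0 : V3) l *
      Literature.Analysis.FunctionSpaces.Torus.partialDeriv l phi x) * (1 * σ ^ 3 * (C * Z')) = 0 := by
    simp
  simp only [] at hE
  rw [localGibbsLaw_eq, hw, hρ] at hE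
  simp only [] at hE
  rw [hring, hcent] at hE
  exact absurd (lt_of_lt_of_le hlt (key'.trans hE)) (lt_irrefl _)

end Summit.AtomisticToContinuum.HydrodynamicLimit.Cruxes.LocalClampedTransferLDAlongFamilies.Disproof
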